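import Summits.Ventures.PercRepro.S1CoreCapEightThreeDis
import Summits.Ventures.PercRepro.S1CoreCapEightFinal

/-!
# PercRepro — `Q*(8) ≤ 25`: THE LAST OPEN CASE CLOSES, THE INSTANCE, THE UNCONDITIONAL TABLE (p1, gen 28)

Three big lines not in a plane at nullity `8`: if two of them meet, the third is in no plane with them (a plane
on all three would be the triangle of `plane_of_three_big`, of `lineRank 3`) and
`sum_cap_le_twenty_five_of_three_big_meet` applies (S1CoreCapEightThreeMeet); otherwise the three are pairwise
disjoint and `sum_cap_le_twenty_five_of_three_disjoint` applies (S1CoreCapEightThreeDis). This is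
`threeBigNonplanarBound₈_holds : ThreeBigNonplanarBound₈`, the one hypothesis of the crude instance
`Eight.fourCapSpec_eight_of_threeBig` (S1CoreCapEightFourAll): **`fourCapSpec_eight : FourCapSpec capPaper 8 25`**
— every configuration of the 4-circuit-cap spec at nullity `8` has cap sum `≤ 25` (the searches' value is `23`).
The table of `S1CoreCapEightFinal` is then unconditional: the spec instances `j ≤ 8` with
`qEight = 0, 1, 4, 5, 8, 11, 16, 19, 25`, at most `25` 4-circuits through a point of an e-free core of nullity `8`,
`s₄ ≤ 89` there (from `92`), `s₄ ≤ avgBoundEight k` at nullity `k + 8` (`89, 124, 169, 225, 294, 378, …`), in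
particular `s₄ ≤ 124` at nullity `9` (from `128`). `proofs/P1-S4-CAPBRIDGE.md` §20. Axioms: standard.
-/

open scoped Matroid

namespace PercRepro

namespace S1

open Set

open FourCap

namespace FourCap

namespace Eight

open Seven

/-- **OPEN CASE A HOLDS AT NULLITY `8`**: three big lines not in a plane give cap sum `≤ 25`. -/
theorem threeBigNonplanarBound₈_holds : ThreeBigNonplanarBound₈ := by
  intro β _ w ls h1 h2 h3 h4 h5 _ L₁ L₂ L₃ hL₁ hL₂ hL₃ h12 h13 h23 c1 c2 c3 hrest hr
  -- no plane contains the three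
  have hnt : ∀ l : List (Finset β), l.Nodup → (∀ L ∈ l, L ∈ ls) → lineRank l ≤ 3 →
      L₁ ∈ l → L₂ ∈ l → L₃ ∈ l → False := by
    intro l hnd hls hrl hl₁ hl₂ hl₃
    obtain ⟨-, -, -, k2, k3, e21, e3⟩ := plane_of_three_big h3 hL₁ hL₂ hL₃ h12 h13 h23 c1 c2 c3 hl₁ hl₂ hl₃
      (h5 l hnd hls hrl)
    have := lineRank_three_of_triangle (L₁ := L₁) (by omega) (by omega) (by omega) e21 e3
    omega
  have p21 := h3 L₂ hL₂ L₁ hL₁ h12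
  have p31 := h3 L₃ hL₃ L₁ hL₁ h13
  have p32 := h3 L₃ hL₃ L₂ hL₂ h23
  by_cases m21 : (L₂ ∩ L₁).card = 1
  · exact sum_cap_le_twenty_five_of_three_big_meet h1 h2 h3 h4 h5 hL₁ hL₂ hL₃ h12 h13 h23 c1 c2 c3 hrest m21
      (fun l hnd hls hrl hl₁ hl₂ hl₃ => hnt l hnd hls hrl hl₁ hl₂ hl₃)
  by_cases m31 : (L₃ ∩ L₁).card = 1
  · exact sum_cap_le_twenty_five_of_three_big_meet h1 h2 h3 h4 h5 hL₁ hL₃ hL₂ h13 h12 h23.symm c1 c3 c2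
      (fun L hL hA hB hC => hrest L hL hA hC hB) m31
      (fun l hnd hls hrl hl₁ hl₃ hl₂ => hnt l hnd hls hrl hl₁ hl₂ hl₃)
  by_cases m32 : (L₃ ∩ L₂).card = 1
  · exact sum_cap_le_twenty_five_of_three_big_meet h1 h2 h3 h4 h5 hL₂ hL₃ hL₁ h23 h12.symm h13.symm c2 c3 c1
      (fun L hL hA hB hC => hrest L hL hC hA hB) m32
      (fun l hnd hls hrl hl₂ hl₃ hl₁ => hnt l hnd hls hrl hl₁ hl₂ hl₃)
  exact sum_cap_le_twenty_five_of_three_disjoint h1 h2 h3 h4 h5 hL₁ hL₂ hL₃ h12 h13 h23 c1 c2 c3 hrest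
    (by omega) (by omega) (by omega)

/-- **THE INSTANCE `ν = 8` IN CRUDE FORM, PROVED**: `FourCapSpec capPaper 8 25`. -/
theorem fourCapSpec_eight : FourCapSpec capPaper 8 25 :=
  fourCapSpec_eight_of_threeBig threeBigNonplanarBound₈_holds

end Eight

end FourCap

variable {α : Type}

/-- The instances `j ≤ 8` of the spec, unconditionally: `qEight = 0, 1, 4, 5, 8, 11, 16, 19, 25`. -/
theorem fourCapSpec_qEight_le_eight : ∀ j ≤ 8, FourCapSpec capPaper j (qEight j) :=
  fourCapSpec_qEight_le_eight_of Eight.threeBigNonplanarBound₈_holds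

/-- **At most `25` 4-circuits through any point of an e-free core of nullity `8`.** -/
theorem ncard_fourCircuitsThrough_le_twenty_five (M : Matroid α) [M.Finite]
    (hfree : ∀ e ∈ M.E, ∃ A ⊆ M.E \ {e}, e ∉ M.closure A ∧ e ∉ M.closure ((M.E \ {e}) \ A))
    (hd : M.E.encard = M.eRank + 8) {e : α} (he : e ∈ M.E) :
    {C : Set α | M.IsCircuit C ∧ C.ncard = 4 ∧ e ∈ C}.ncard ≤ 25 :=
  ncard_fourCircuitsThrough_le_twenty_five_of Eight.threeBigNonplanarBound₈_holds M hfree hd he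

/-- **`s₄ ≤ 89` on every e-free core of nullity `8`** (from `92`). -/
theorem ncard_fourCircuits_le_eighty_nine (M : Matroid α) [M.Finite]
    (hfree : ∀ e ∈ M.E, ∃ A ⊆ M.E \ {e}, e ∉ M.closure A ∧ e ∉ M.closure ((M.E \ {e}) \ A))
    (hd : M.E.encard = M.eRank + 8) : {C : Set α | M.IsCircuit C ∧ C.ncard = 4}.ncard ≤ 89 :=
  ncard_fourCircuits_le_eighty_nine_of Eight.threeBigNonplanarBound₈_holds M hfree hd

/-- **`s₄ ≤ avgBoundEight k` on every e-free core of nullity `k + 8`**: `89, 124, 169, 225, 294, 378, …`. -/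
theorem ncard_fourCircuits_le_avgBoundEight (k : ℕ) (M : Matroid α) [M.Finite]
    (hfree : ∀ e ∈ M.E, ∃ A ⊆ M.E \ {e}, e ∉ M.closure A ∧ e ∉ M.closure ((M.E \ {e}) \ A))
    (hd : M.E.encard = M.eRank + (k + 8)) :
    {C : Set α | M.IsCircuit C ∧ C.ncard = 4}.ncard ≤ avgBoundEight k :=
  ncard_fourCircuits_le_avgBoundEight_of Eight.threeBigNonplanarBound₈_holds k M hfree hd

/-- **`s₄ ≤ 124` on every e-free core of nullity `9`** (from `128`). -/
theorem ncard_fourCircuits_le_one_hundred_twenty_four (M : Matroid α) [M.Finite]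
    (hfree : ∀ e ∈ M.E, ∃ A ⊆ M.E \ {e}, e ∉ M.closure A ∧ e ∉ M.closure ((M.E \ {e}) \ A))
    (hd : M.E.encard = M.eRank + 9) : {C : Set α | M.IsCircuit C ∧ C.ncard = 4}.ncard ≤ 124 :=
  ncard_fourCircuits_le_one_hundred_twenty_four_of Eight.threeBigNonplanarBound₈_holds M hfree hd

end S1

end PercRepro
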